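import Mathlib
import HarnessLib
import Literature.Geometry.Lorentzian.Stationary
import Literature.Geometry.Lorentzian.KerrData
import Literature.Geometry.Lorentzian.Isometry
import Literature.Geometry.Lorentzian.Einstein
import Literature.Geometry.Lorentzian.Geodesic
import Literature.Geometry.Lorentzian.Causality
import Literature.Geometry.Lorentzian.IPlusRegular
import Literature.Geometry.Lorentzian.GeodesicProofs
import Literature.Geometry.Lorentzian.CoordinateFrames
import Literature.Geometry.Lorentzian.NullScreenAlgebra
import Literature.Geometry.Lorentzian.ZeroEnergyRayTrappedModFlow
import Literature.Geometry.Lorentzian.StationaryBlackHoleUniquenessProofs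

/-!
# `ErgoregionBombModT` — the wall / off-wall split (crux stmt-FinalStateConjecture-17838)

Route `ZeroEnergyKerrOrBomb` of the Final State Conjecture, crux
`Summit.FinalStateConjecture.FinalStateConjecture.Theses.ZeroEnergyKerrOrBomb.ErgoregionBombModT`
(the ergoregion bomb modulo the stationary flow).  This support file proves the REDUCTION

  `ErgoregionBombModT ⇐ OffWallBomb ∧ NoDocLightPoints`

(theorem `ergoregionBombModT_of_offWall_of_noDocLightPoints`; the conclusion is the body of the
route decl VERBATIM, so that the theorem's type δ-unfolds to `ErgoregionBombModT` and the file stays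
free of the `Theses` import), where

* `OffWallBomb` is the crux with ONE extra antecedent clause, inserted after the trapping clause:
  `∃ t ∈ s, 0 < g(T, T)(γ t)` — the trapped zero-energy null geodesic ENTERS the open ergoregion;
* `NoDocLightPoints` is the pointwise geometric statement, in the crux's own telescope prefix:
  at no point `p` of the domain of outer communications with `g(T, T)(p) = 0` is `∇_T T`
  proportional to `T` (no "Killing light point" in the d.o.c.).

Both hypotheses are written out in full (they are not items of the route; the planners decide
whether to file them), following the house pattern "reduction theorem first, hypotheses = the item
text restricted to each branch".

## The mathematics (crux idea card `killing-light-points`, ideator 2, 2026-08-17)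

Let `λ := g(T,T)`.  Given the crux's data — a maximal null geodesic `γ` on the open interval `s`,
`γ̇ ≠ 0`, `g(γ̇, T) = 0`, inside the `T`-orbit of a compact `S ⊆ ⟨⟨M_ext⟩⟩` — either `λ(γ t) > 0`
for some `t ∈ s` (apply `OffWallBomb`), or `λ ∘ γ ≤ 0` on `s`.  In the second case:
(1) every `γ t` lies in the d.o.c. (the d.o.c. is invariant under the stationary flow,
`StationaryAFBlackHole.mem_doc_of_isMIntegralCurve`), so `T(γ t) ≠ 0` by the telescope;
(2) `λ(γ t) ≥ 0` by the cage lemma `killing_sq_nonneg_of_zeroEnergyNull` (a non-zero null vector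
orthogonal to `T` forbids `T` timelike), hence `λ ∘ γ = 0` on `s`: the geodesic runs inside the
stationary limit surface; (3) at each `t ∈ s` the null vectors `γ̇(t)` and `T(γ t)` are orthogonal,
hence collinear (`exists_smul_of_orthogonal_null`, O'Neill 1983 Ch. 5 Lemma 5.28): `γ̇ = c · (T ∘ γ)`
with `c ≠ 0`; (4) the geodesic equation then gives `0 = D(c T∘γ)/dt = c' T + c² ∇_T T`, so
`∇_T T = -(c'/c²) T` at `γ t₀` (`exists_cov_self_eq_smul_of_velocity_parallel`, the Leibniz and
restriction rules of O'Neill 1983 Ch. 3 Prop. 3.18, discharged in the tree as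
`covariantDerivAlong_smul_holds` / `covariantDerivAlong_comp_holds`; the coefficient `c` is made
differentiable as a quotient of local-frame coefficients) — `γ t₀` is a light point of the d.o.c.,
contradicting `NoDocLightPoints`.

So the served crux splits EXACTLY into the off-wall bomb (the statement every wave-mechanical idea
for this crux is about: along an off-wall segment `T` is spacelike and the optical quotient is
non-degenerate) and a statement about the 1-jet of the Killing norm on the stationary limit surface
(`(∇λ)² = ω² > 0` on `{λ = 0} ∩ ⟨⟨M_ext⟩⟩`), which belongs with the rigidity side of the route's
dichotomy.  Nothing here claims either conjunct.

References: B. O'Neill, *Semi-Riemannian geometry* (1983), Ch. 3 Prop. 3.18, Ch. 5 Lemma 5.26–5.28;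
S. W. Hawking, G. F. R. Ellis (1973), §9.3 p. 331 (null Killing orbits on the stationary limit
surface, after Hájíček 1973); crux workfiles `Cruxes/ErgoregionBombModT/Ideas/killing-light-points.md`,
`SketchIdeator2.lean` (`LightPointInhabitsAntecedent`, the converse direction, typed there).
-/

noncomputable section

open Bundle Set Filter Function
open scoped Manifold Topology

-- summit = problem name (D-0017)
set_option linter.dupNamespace false

namespace Summit.FinalStateConjecture.FinalStateConjecture.Theorems.ErgoregionBombModT

open Literature.Geometry.Lorentzian

section Calculus

open scoped ContDiff

variable {E : Type*} [NormedAddCommGroup E] [NormedSpace ℝ E] {H : Type*} [TopologicalSpace H]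
  {I : ModelWithCorners ℝ E H} {M : Type*} [TopologicalSpace M] [ChartedSpace H M]
  [IsManifold I ∞ M] [FiniteDimensional ℝ E]

/-- **Locality of `D/dt` in the field** (private copy of the folklore congruence lemma): the
covariant derivative along `γ` at `t₀` only depends on the germ at `t₀` of the field along `γ`.
O'Neill 1983, Ch. 3, Prop. 3.18 (the frame formula differentiates the coefficient functions at
`t₀`). -/
private theorem covariantDerivAlong_congr_field'
    (cov : CovariantDerivative I E (TangentSpace I : M → Type _))
    {γ : ℝ → M} {W W' : Π t : ℝ, TangentSpace I (γ t)} {t₀ : ℝ}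
    (h : ∀ᶠ t in 𝓝 t₀, W' t = W t) :
    covariantDerivAlong cov γ W' t₀ = covariantDerivAlong cov γ W t₀ := by
  simp only [covariantDerivAlong, covariantDerivAlongFrame]
  have h0 : W' t₀ = W t₀ := h.self_of_nhds
  congr 1
  · refine Finset.sum_congr rfl fun i _ ↦ ?_
    congr 1
    apply Filter.EventuallyEq.deriv_eq
    filter_upwards [h] with t ht
    rw [ht]
  · rw [h0]

/-- **A geodesic running along the lines of a vector field sits on pregeodesic points of the
field.** Let `γ` be twice differentiable at `t₀` with vanishing acceleration `D(γ̇)/dt (t₀) = 0`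
(the geodesic equation of `cov` at `t₀`), let `X` be a vector field differentiable at `γ t₀`, and
suppose that near `t₀` the velocity `γ̇(t)` is a multiple of `X (γ t)`, with `γ̇(t₀) ≠ 0`. Then
`∇_X X` is proportional to `X` at `γ t₀`: writing `γ̇ = c · (X ∘ γ)` with `c` differentiable at
`t₀` (a quotient of frame coefficients), the Leibniz rule and `D(X ∘ γ)/dt = ∇_{γ̇} X` give
`0 = c' X + c² ∇_X X`, and `c(t₀) ≠ 0`. O'Neill 1983, Ch. 3, Prop. 3.18 (2)–(3) (the two rules
used); this is the computation behind "an integral curve of `X` is a pregeodesic iff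
`∇_X X ∥ X` along it". -/
theorem exists_cov_self_eq_smul_of_velocity_parallel
    (cov : CovariantDerivative I E (TangentSpace I : M → Type _))
    {γ : ℝ → M} {X : Π x : M, TangentSpace I x} {t₀ : ℝ}
    (hlift : MDifferentiableAt 𝓘(ℝ, ℝ) I.tangent (tangentLift I γ) t₀)
    (hgeo : covariantDerivAlong cov γ (fun t ↦ velocity I γ t) t₀ = 0)
    (hX : MDiffAt (T% X) (γ t₀))
    (hpar : ∀ᶠ t in 𝓝 t₀, ∃ a : ℝ, velocity I γ t = a • X (γ t))
    (hv0 : velocity I γ t₀ ≠ 0) :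
    ∃ κ : ℝ, cov X (γ t₀) (X (γ t₀)) = κ • X (γ t₀) := by
  -- `γ` is differentiable at `t₀`, and so is the lift of `X ∘ γ`
  have hγ : MDifferentiableAt 𝓘(ℝ, ℝ) I γ t₀ := mdifferentiableAt_of_mdifferentiableAt_lift hlift
  have hW : MDifferentiableAt 𝓘(ℝ, ℝ) I.tangent
      (fun t ↦ (TotalSpace.mk' E (γ t) (X (γ t)) : TangentBundle I M)) t₀ := hX.comp t₀ hγ
  set e := trivializationAt E (TangentSpace I : M → Type _) (γ t₀) with he_def
  set b := Module.finBasis ℝ E with hb_def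
  have he : γ t₀ ∈ e.baseSet := FiberBundle.mem_baseSet_trivializationAt' (γ t₀)
  -- `X (γ t₀) ≠ 0`
  obtain ⟨a₀, ha₀⟩ := hpar.self_of_nhds
  have hX0 : X (γ t₀) ≠ 0 := by
    intro h
    apply hv0
    rw [ha₀, h, smul_zero]
  -- a frame coefficient of `X` which does not vanish at `γ t₀`
  obtain ⟨i, hi⟩ : ∃ i, e.localFrame_coeff I b i (γ t₀) (X (γ t₀)) ≠ 0 := by
    by_contra hall
    push Not at hall
    apply hX0
    rw [e.eq_sum_localFrame_coeff_smul (I := I) (b := b) (s := fun _ ↦ X (γ t₀)) he]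
    exact Finset.sum_eq_zero fun j _ ↦ by rw [hall j, zero_smul]
  -- the coefficient functions of `X ∘ γ` and of `γ̇` along `γ`
  set cX : ℝ → ℝ := fun t ↦ e.localFrame_coeff I b i (γ t) (X (γ t)) with hcX_def
  set cV : ℝ → ℝ := fun t ↦ e.localFrame_coeff I b i (γ t) (velocity I γ t) with hcV_def
  have hcX : DifferentiableAt ℝ cX t₀ := differentiableAt_localFrame_coeff_lift e b hW he i
  have hcV : DifferentiableAt ℝ cV t₀ := differentiableAt_localFrame_coeff_lift e b hlift he i
  have hcX0 : cX t₀ ≠ 0 := hi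
  -- the ratio `c = cV / cX` is differentiable at `t₀` and `γ̇ = c • (X ∘ γ)` near `t₀`
  set c : ℝ → ℝ := fun t ↦ cV t / cX t with hc_def
  have hc : DifferentiableAt ℝ c t₀ := hcV.div hcX hcX0
  have hne : ∀ᶠ t in 𝓝 t₀, cX t ≠ 0 := hcX.continuousAt.eventually_ne hcX0
  have hEq : ∀ᶠ t in 𝓝 t₀, velocity I γ t = c t • X (γ t) := by
    filter_upwards [hpar, hne] with t ht hne
    obtain ⟨a, ha⟩ := ht
    have hca : c t = a := by
      have hne' : e.localFrame_coeff I b i (γ t) (X (γ t)) ≠ 0 := hne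
      simp only [hc_def, hcV_def, hcX_def, ha, map_smul, smul_eq_mul]
      exact mul_div_cancel_right₀ a hne'
    rw [hca, ha]
  have hc0 : c t₀ ≠ 0 := by
    intro h
    apply hv0
    rw [hEq.self_of_nhds, h, zero_smul]
  -- the geodesic equation for `c • (X ∘ γ)`
  have h1 : covariantDerivAlong cov γ (fun t ↦ c t • X (γ t)) t₀ = 0 := by
    rw [← hgeo]
    exact covariantDerivAlong_congr_field' cov (W := fun t ↦ velocity I γ t)
      (W' := fun t ↦ c t • X (γ t)) (by filter_upwards [hEq] with t ht using ht.symm)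
  have h2 := covariantDerivAlong_smul_holds cov (γ := γ) (W := fun t ↦ X (γ t)) (f := c)
    (t₀ := t₀) hc hW
  have h3 := covariantDerivAlong_comp_holds cov (γ := γ) (Y := X) (t₀ := t₀) hγ hX
  rw [h1, h3, hEq.self_of_nhds, map_smul, smul_smul] at h2
  -- `0 = c' • X + (c * c) • ∇_X X`
  refine ⟨-(deriv c t₀ / (c t₀ * c t₀)), ?_⟩
  have h4 : (c t₀ * c t₀) • cov X (γ t₀) (X (γ t₀)) = -(deriv c t₀ • X (γ t₀)) :=
    eq_neg_of_add_eq_zero_right h2.symm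
  have hcc : c t₀ * c t₀ ≠ 0 := mul_ne_zero hc0 hc0
  calc cov X (γ t₀) (X (γ t₀))
      = (c t₀ * c t₀)⁻¹ • ((c t₀ * c t₀) • cov X (γ t₀) (X (γ t₀))) := by
        rw [smul_smul, inv_mul_cancel₀ hcc, one_smul]
    _ = -(deriv c t₀ / (c t₀ * c t₀)) • X (γ t₀) := by
        rw [h4, smul_neg, smul_smul, neg_smul, div_eq_inv_mul]


end Calculus

/-! ### The reduction -/

/-- **`ErgoregionBombModT ⇐ OffWallBomb ∧ NoDocLightPoints`.**  If the ergoregion bomb modulo the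
flow holds for trapped zero-energy null geodesics that ENTER the open ergoregion `{g(T,T) > 0}`
(hypothesis `hOff`: the crux with the extra clause `∃ t ∈ s, 0 < g(T,T)(γ t)`), and if the domain
of outer communications of every hole of the telescope carries no Killing light point (hypothesis
`hNo`: `g(T,T)(p) = 0 ⇒ ∇_T T ∦ T` at `p ∈ ⟨⟨M_ext⟩⟩`), then the crux
`Theses.ZeroEnergyKerrOrBomb.ErgoregionBombModT` holds — the conclusion below is its body verbatim.
Proof: a trapped ray which never enters `{g(T,T) > 0}` runs, by the cage lemma, inside
`{g(T,T) = 0} ∩ ⟨⟨M_ext⟩⟩`, where its null `T`-orthogonal velocity is a multiple of the null `T`,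
so by the geodesic equation `∇_T T ∥ T` at each of its points (module docstring, steps (1)–(4)). -/
theorem ergoregionBombModT_of_offWall_of_noDocLightPoints
    (hOff : ∀ (𝓑 : Literature.Geometry.Lorentzian.StationaryAFBlackHole.{0}) [𝓑.metric.HasLeviCivita] [Literature.Geometry.Lorentzian.Kerr.Facts], 𝓑.metric.toPseudoRiemannianMetric.IsRicciFlat → 𝓑.IsIPlusRegular → (∀ p : 𝓑.carrier, p ∈ 𝓑.metric.chronologicalFuture 𝓑.timeOrientation 𝓑.Mext) → (∀ p ∈ 𝓑.doc, 𝓑.killing p ≠ 0) → SimplyConnectedSpace 𝓑.doc → ∀ (U : Set 𝓑.carrier) (K : Π x : 𝓑.carrier, TangentSpace (𝓡 4) x), IsOpen U → 𝓑.horizon ⊆ U → IsConnected 𝓑.horizon → ContMDiffOn (𝓡 4) ((𝓡 4).prod 𝓘(ℝ, Literature.Geometry.Lorentzian.E4)) ((⊤ : ℕ∞) : WithTop ℕ∞) (fun x ↦ (Bundle.TotalSpace.mk' Literature.Geometry.Lorentzian.E4 x (K x) : TangentBundle (𝓡 4) 𝓑.carrier)) U → (∀ x ∈ U, ∀ v w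 : TangentSpace (𝓡 4) x, 𝓑.metric.val x (𝓑.metric.leviCivita K x v) w + 𝓑.metric.val x v (𝓑.metric.leviCivita K x w) = 0) → (∀ x ∈ U, VectorField.mlieBracket (𝓡 4) 𝓑.killing K x = 0) → (∀ p ∈ 𝓑.horizon, K p ≠ 0) → (∀ γ : ℝ → 𝓑.carrier, IsMIntegralCurve γ K → γ 0 ∈ 𝓑.horizon → ∀ t, γ t ∈ 𝓑.horizon) → (∀ x ∈ U ∩ 𝓑.doc, 𝓑.metric.val x (K x) (K x) < 0) → (∃ S₀ : Set 𝓑.carrier, IsCompact S₀ ∧ S₀ ⊆ 𝓑.doc ∧ ∀ y ∈ 𝓑.doc, 0 ≤ 𝓑.metric.val y (𝓑.killing y) (𝓑.killing y) → y ∉ U → y ∈ Literature.Geometry.Lorentzian.stationaryOrbit 𝓑.killing S₀) → ∀ S : Set 𝓑.carrier, IsCompact S → S ⊆ 𝓑.doc → ∀ (γ : ℝ → 𝓑.carrier) (s : Set ℝ), Literature.Geometry.Lorentzian.IsMaximalGeodesicOn 𝓑.metric.toPseudoRiemannianMetric.leviCivita γ s → s.Nonempty → (∀ t ∈ s, 𝓑.metric.val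 (γ t) (Literature.Geometry.Lorentzian.velocity (𝓡 4) γ t) (Literature.Geometry.Lorentzian.velocity (𝓡 4) γ t) = 0 ∧ Literature.Geometry.Lorentzian.velocity (𝓡 4) γ t ≠ 0 ∧ 𝓑.metric.val (γ t) (Literature.Geometry.Lorentzian.velocity (𝓡 4) γ t) (𝓑.killing (γ t)) = 0) → (∀ t ∈ s, γ t ∈ Literature.Geometry.Lorentzian.stationaryOrbit 𝓑.killing S) → (∃ t ∈ s, 0 < 𝓑.metric.val (γ t) (𝓑.killing (γ t)) (𝓑.killing (γ t))) → ∃ (ν ω : ℝ) (ψ χ : 𝓑.carrier → ℝ), 0 < ν ∧ (∃ U : Set 𝓑.carrier, IsOpen U ∧ 𝓑.doc ∪ 𝓑.horizon ⊆ U ∧ ContMDiffOn (𝓡 4) 𝓘(ℝ, ℝ) ((⊤ : ℕ∞) : WithTop ℕ∞) ψ U ∧ ContMDiffOn (𝓡 4) 𝓘(ℝ, ℝ) ((⊤ : ℕ∞) : WithTop ℕ∞) χ U) ∧ (∀ x ∈ 𝓑.doc, 𝓑.metric.dalembertian ψ x = 0 ∧ 𝓑.metric.dalembertian χ x = 0)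 ∧ (∀ x ∈ 𝓑.doc, mfderiv (𝓡 4) 𝓘(ℝ, ℝ) ψ x (𝓑.killing x) = ν * ψ x - ω * χ x ∧ mfderiv (𝓡 4) 𝓘(ℝ, ℝ) χ x (𝓑.killing x) = ω * ψ x + ν * χ x) ∧ (∃ C : ℝ, ∀ x ∈ 𝓑.doc ∩ 𝓑.metric.chronologicalPast 𝓑.timeOrientation (𝓑.embed '' 𝓑.e.far (𝓑.e.R + 1)), |ψ x| ≤ C ∧ |χ x| ≤ C) ∧ ∃ x ∈ 𝓑.doc, ψ x ≠ 0 ∨ χ x ≠ 0)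
    (hNo : ∀ (𝓑 : Literature.Geometry.Lorentzian.StationaryAFBlackHole.{0}) [𝓑.metric.HasLeviCivita] [Literature.Geometry.Lorentzian.Kerr.Facts], 𝓑.metric.toPseudoRiemannianMetric.IsRicciFlat → 𝓑.IsIPlusRegular → (∀ p : 𝓑.carrier, p ∈ 𝓑.metric.chronologicalFuture 𝓑.timeOrientation 𝓑.Mext) → (∀ p ∈ 𝓑.doc, 𝓑.killing p ≠ 0) → SimplyConnectedSpace 𝓑.doc → ∀ (U : Set 𝓑.carrier) (K : Π x : 𝓑.carrier, TangentSpace (𝓡 4) x), IsOpen U → 𝓑.horizon ⊆ U → IsConnected 𝓑.horizon → ContMDiffOn (𝓡 4) ((𝓡 4).prod 𝓘(ℝ, Literature.Geometry.Lorentzian.E4)) ((⊤ : ℕ∞) : WithTop ℕ∞) (fun x ↦ (Bundle.TotalSpace.mk' Literature.Geometry.Lorentzian.E4 x (K x) : TangentBundle (𝓡 4) 𝓑.carrier)) U → (∀ x ∈ U, ∀ v w : TangentSpace (𝓡 4) x, 𝓑.metric.val x (𝓑.metric.leviCivita K x v) w + 𝓑.metric.val x v (𝓑.metric.leviCivita K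 x w) = 0) → (∀ x ∈ U, VectorField.mlieBracket (𝓡 4) 𝓑.killing K x = 0) → (∀ p ∈ 𝓑.horizon, K p ≠ 0) → (∀ γ : ℝ → 𝓑.carrier, IsMIntegralCurve γ K → γ 0 ∈ 𝓑.horizon → ∀ t, γ t ∈ 𝓑.horizon) → (∀ x ∈ U ∩ 𝓑.doc, 𝓑.metric.val x (K x) (K x) < 0) → (∃ S₀ : Set 𝓑.carrier, IsCompact S₀ ∧ S₀ ⊆ 𝓑.doc ∧ ∀ y ∈ 𝓑.doc, 0 ≤ 𝓑.metric.val y (𝓑.killing y) (𝓑.killing y) → y ∉ U → y ∈ Literature.Geometry.Lorentzian.stationaryOrbit 𝓑.killing S₀) → ∀ p ∈ 𝓑.doc, 𝓑.metric.val p (𝓑.killing p) (𝓑.killing p) = 0 → ∀ κ : ℝ, 𝓑.metric.leviCivita 𝓑.killing p (𝓑.killing p) ≠ κ • 𝓑.killing p) :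
    ∀ (𝓑 : Literature.Geometry.Lorentzian.StationaryAFBlackHole.{0}) [𝓑.metric.HasLeviCivita] [Literature.Geometry.Lorentzian.Kerr.Facts], 𝓑.metric.toPseudoRiemannianMetric.IsRicciFlat → 𝓑.IsIPlusRegular → (∀ p : 𝓑.carrier, p ∈ 𝓑.metric.chronologicalFuture 𝓑.timeOrientation 𝓑.Mext) → (∀ p ∈ 𝓑.doc, 𝓑.killing p ≠ 0) → SimplyConnectedSpace 𝓑.doc → ∀ (U : Set 𝓑.carrier) (K : Π x : 𝓑.carrier, TangentSpace (𝓡 4) x), IsOpen U → 𝓑.horizon ⊆ U → IsConnected 𝓑.horizon → ContMDiffOn (𝓡 4) ((𝓡 4).prod 𝓘(ℝ, Literature.Geometry.Lorentzian.E4)) ((⊤ : ℕ∞) : WithTop ℕ∞) (fun x ↦ (Bundle.TotalSpace.mk' Literature.Geometry.Lorentzian.E4 x (K x) : TangentBundle (𝓡 4) 𝓑.carrier)) U → (∀ x ∈ U, ∀ v w : TangentSpace (𝓡 4) x, 𝓑.metric.val x (𝓑.metric.leviCivita K x v) w + 𝓑.metric.val x v (𝓑.metric.leviCivita K x w) = 0)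 → (∀ x ∈ U, VectorField.mlieBracket (𝓡 4) 𝓑.killing K x = 0) → (∀ p ∈ 𝓑.horizon, K p ≠ 0) → (∀ γ : ℝ → 𝓑.carrier, IsMIntegralCurve γ K → γ 0 ∈ 𝓑.horizon → ∀ t, γ t ∈ 𝓑.horizon) → (∀ x ∈ U ∩ 𝓑.doc, 𝓑.metric.val x (K x) (K x) < 0) → (∃ S₀ : Set 𝓑.carrier, IsCompact S₀ ∧ S₀ ⊆ 𝓑.doc ∧ ∀ y ∈ 𝓑.doc, 0 ≤ 𝓑.metric.val y (𝓑.killing y) (𝓑.killing y) → y ∉ U → y ∈ Literature.Geometry.Lorentzian.stationaryOrbit 𝓑.killing S₀) → ∀ S : Set 𝓑.carrier, IsCompact S → S ⊆ 𝓑.doc → ∀ (γ : ℝ → 𝓑.carrier) (s : Set ℝ), Literature.Geometry.Lorentzian.IsMaximalGeodesicOn 𝓑.metric.toPseudoRiemannianMetric.leviCivita γ s → s.Nonempty → (∀ t ∈ s, 𝓑.metric.val (γ t) (Literature.Geometry.Lorentzian.velocity (𝓡 4) γ t) (Literature.Geometry.Lorentzian.velocity (𝓡 4) γ t) = 0 ∧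 Literature.Geometry.Lorentzian.velocity (𝓡 4) γ t ≠ 0 ∧ 𝓑.metric.val (γ t) (Literature.Geometry.Lorentzian.velocity (𝓡 4) γ t) (𝓑.killing (γ t)) = 0) → (∀ t ∈ s, γ t ∈ Literature.Geometry.Lorentzian.stationaryOrbit 𝓑.killing S) → ∃ (ν ω : ℝ) (ψ χ : 𝓑.carrier → ℝ), 0 < ν ∧ (∃ U : Set 𝓑.carrier, IsOpen U ∧ 𝓑.doc ∪ 𝓑.horizon ⊆ U ∧ ContMDiffOn (𝓡 4) 𝓘(ℝ, ℝ) ((⊤ : ℕ∞) : WithTop ℕ∞) ψ U ∧ ContMDiffOn (𝓡 4) 𝓘(ℝ, ℝ) ((⊤ : ℕ∞) : WithTop ℕ∞) χ U) ∧ (∀ x ∈ 𝓑.doc, 𝓑.metric.dalembertian ψ x = 0 ∧ 𝓑.metric.dalembertian χ x = 0) ∧ (∀ x ∈ 𝓑.doc, mfderiv (𝓡 4) 𝓘(ℝ, ℝ) ψ x (𝓑.killing x) = ν * ψ x - ω * χ x ∧ mfderiv (𝓡 4) 𝓘(ℝ, ℝ) χ x (𝓑.killing x) = ω * ψ x + ν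 * χ x) ∧ (∃ C : ℝ, ∀ x ∈ 𝓑.doc ∩ 𝓑.metric.chronologicalPast 𝓑.timeOrientation (𝓑.embed '' 𝓑.e.far (𝓑.e.R + 1)), |ψ x| ≤ C ∧ |χ x| ≤ C) ∧ ∃ x ∈ 𝓑.doc, ψ x ≠ 0 ∨ χ x ≠ 0 := by
  intro 𝓑 _ _ hRic hReg hpres hT0 hsc U K hU hHU hconn hKs hKill hcomm hK0 hKtan hKtime hbelt S hS
    hSdoc γ s hmax hs hz htrap
  by_cases hwall : ∃ t ∈ s, 0 < 𝓑.metric.val (γ t) (𝓑.killing (γ t)) (𝓑.killing (γ t))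
  · exact hOff 𝓑 hRic hReg hpres hT0 hsc U K hU hHU hconn hKs hKill hcomm hK0 hKtan hKtime hbelt S
      hS hSdoc γ s hmax hs hz htrap hwall
  exfalso
  push Not at hwall
  obtain ⟨t₀, ht₀⟩ := hs
  -- (1) the geodesic lies in the d.o.c. (flow-invariance of `⟨⟨M_ext⟩⟩`)
  have hdoc : ∀ t ∈ s, γ t ∈ 𝓑.doc := fun t ht ↦ by
    obtain ⟨δ, hδ, hδ0, u, hu⟩ := htrap t ht
    rw [← hu]
    exact StationaryAFBlackHole.mem_doc_of_isMIntegralCurve hδ (hSdoc hδ0) u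
  -- (2) `g(T,T) = 0` along the geodesic (cage lemma and the wall hypothesis)
  have hlam : ∀ t ∈ s, 𝓑.metric.val (γ t) (𝓑.killing (γ t)) (𝓑.killing (γ t)) = 0 :=
    fun t ht ↦ le_antisymm (hwall t ht)
      (𝓑.killing_sq_nonneg_of_zeroEnergyNull (hz t ht).1 (hz t ht).2.1 (hz t ht).2.2)
  -- (3) the velocity is a multiple of `T` along the geodesic (orthogonal null vectors)
  have hpar : ∀ t ∈ s, ∃ a : ℝ, velocity (𝓡 4) γ t = a • 𝓑.killing (γ t) := fun t ht ↦ by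
    obtain ⟨w, hw⟩ := 𝓑.metric.exists_timelike (γ t)
    exact exists_smul_of_orthogonal_null (V := E4) (𝓑.metric.val (γ t)) (𝓑.metric.symm (γ t))
      (fun a b ha hab hb ↦ 𝓑.metric.pos_of_orthogonal (γ t) a b ha hab hb) hw (hlam t ht)
      (hT0 _ (hdoc t ht)) (hz t ht).2.2 (hz t ht).1
  -- (4) the geodesic equation makes `γ t₀` a light point
  have hsn : s ∈ 𝓝 t₀ := hmax.1.mem_nhds ht₀
  have hK1 : ContMDiff (𝓡 4) (𝓡 4).tangent 1
      (fun x ↦ (⟨x, 𝓑.killing x⟩ : TangentBundle (𝓡 4) 𝓑.carrier)) :=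
    𝓑.isStationaryKilling.isKillingField.contMDiff.of_le (WithTop.coe_le_coe.mpr le_top)
  have hTs : MDifferentiableAt (𝓡 4) (𝓡 4).tangent
      (fun x ↦ (TotalSpace.mk' E4 x (𝓑.killing x) : TangentBundle (𝓡 4) 𝓑.carrier)) (γ t₀) :=
    hK1.mdifferentiableAt one_ne_zero
  obtain ⟨κ, hκ⟩ := exists_cov_self_eq_smul_of_velocity_parallel
    𝓑.metric.toPseudoRiemannianMetric.leviCivita (hmax.2.2.1.1 t₀ ht₀) (hmax.2.2.1.2 t₀ ht₀) hTs
    (by filter_upwards [hsn] with t ht using hpar t ht) (hz t₀ ht₀).2.1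
  exact hNo 𝓑 hRic hReg hpres hT0 hsc U K hU hHU hconn hKs hKill hcomm hK0 hKtan hKtime hbelt (γ t₀)
    (hdoc t₀ ht₀) (hlam t₀ ht₀) κ hκ

end Summit.FinalStateConjecture.FinalStateConjecture.Theorems.ErgoregionBombModT

end
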